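import Literature.Claims.NS.ClayVariants
import Literature.Analysis.FluidPDE.PeriodicPressureNormalisation
import HarnessLib

/-!
# Clay (B)/(D): the printed periodicity condition (10) and the CMI erratum are equivalent for `f ≡ 0`

Reference file of the D-0090 «where NS proofs break» sweep (cell `ns-claims`), companion of
`Literature/Claims/NS/ClayVariants.lean` (same namespace; kept in its own file so that the claim
skeletons importing `ClayVariants` do not acquire the Seeley-extension / Galilean-boost closure).
It draws the Clay-schema consequences of the pressure-normalisation theorem
`Literature.Analysis.FluidPDE.IsNavierStokesSolution.exists_pressurePeriodic_of_velocityPeriodic_zero`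
(Tao 2013, Lemma 4.1 (ii) with the Galilean symmetry of §3 [Tao2013Localisation]; in the tree,
`Literature/Analysis/FluidPDE/PeriodicPressureNormalisation.lean`).

Fefferman's periodic statements (B), (D) ask, as printed, condition (10) `u(x + eⱼ, t) = u(x, t)` of
the SOLUTION VELOCITY only [FeffermanClay2006, (10) p. 2]; the errata page of the CMI offprint adds
"The further condition `p(x + eⱼ, t) = p(x, t)` should be made explicit" (the spec
`ClayVariants.clayPeriodicErrata`). For the UNFORCED problem the two solution classes have the same
solvable Cauchy problems: a smooth solution with periodic velocity is carried by a Galilean boost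
(frame acceleration = minus the linear part of the pressure) to a smooth solution with the same
datum and periodic velocity AND pressure ("normalised pressure … is equivalent to requiring that the
pressure be periodic" [Tao2013Localisation, footnote to (1.8)]; "this symmetry is in some sense
degenerate", §1 after Prop. 1.7).

## What is proved (all `theorem`s, no named facts)

* `clayPeriodic_solvable_zero_iff_errata` — `clayPeriodic.Solvable ν 0 u₀ ↔ clayPeriodicErrata.Solvable ν 0 u₀`;
* `clayPeriodicErrata_regularityAt_iff` — errata-(B) at `ν` ⇔ printed (B) at `ν`;
  `clayPeriodicErrata_regularity_iff` — **errata-(B) ⇔ (B)** (the leaf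
  `NavierStokesExistenceSmoothPeriodic`); so a REGULARITY claim proved in either pressure convention
  settles (B), and the converse `clayPeriodicErrata_regularity_imp_printed` of `ClayVariants` is now an
  equivalence;
* `clayPeriodic_breakdownAt_of_not_errataSolvable_zero`,
  **`navierStokesBreakdownPeriodic_of_not_errataSolvable_zero`** — an UNFORCED periodic counterexample
  at ONE viscosity that excludes only solutions with `u(·,t)` AND `p(·,t)` periodic (the form in which
  papers using the normalised / mean-zero periodic pressure state non-existence) proves PRINTED (D)
  (the leaf `NavierStokesBreakdownPeriodic`) — the Δ5 axis «pressure periodic» of the `ClayVariants`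
  docstring is thereby EQUIVALENT, not a delta, for unforced periodic claims; with a nonzero force it
  remains a delta (Tao's Prop. 1.7: the boost changes the force, `f(t, · + ξ(t))`).

## References

* [FeffermanClay2006] C. L. Fefferman, Existence and smoothness of the Navier–Stokes equation, CMI
  (2000/2006): (B), (D), (10) p. 2; errata page of the offprint.
* [Tao2013Localisation] T. Tao, Anal. PDE 6 (2013) 25–107, arXiv:1108.1165: Lemma 4.1 (ii), §3
  eq. (galilean), §1 after Prop. 1.7, footnote to (1.8).

WHAT THIS IS NOT: not a claim about NS regularity or blow-up; not a claim about any author beyond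
the typed locator.
-/

open scoped ContDiff

namespace Literature.Claims.NS.ClayVariants

open Literature.Analysis.FluidPDE

noncomputable section

/-- **Printed (10) and the errata condition have the same unforced solvable Cauchy problems**:
`clayPeriodic.Solvable ν 0 u₀ ↔ clayPeriodicErrata.Solvable ν 0 u₀` (pressure normalisation by a
Galilean boost, `IsNavierStokesSolution.exists_pressurePeriodic_of_velocityPeriodic_zero`; the
converse forgets the pressure condition). [cite: Tao2013Localisation, Lemma 4.1 (ii), §3 eq. (galilean), footnote to (1.8)]
[cite: FeffermanClay2006, (10) p. 2 and errata] -/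
theorem clayPeriodic_solvable_zero_iff_errata (ν : ℝ)
    (u₀ : EuclideanSpace ℝ (Fin 3) → EuclideanSpace ℝ (Fin 3)) :
    clayPeriodic.Solvable ν 0 u₀ ↔ clayPeriodicErrata.Solvable ν 0 u₀ :=
  exists_velocityPeriodic_iff_exists_pressurePeriodic ν u₀

/-- **Errata-(B) at one viscosity ⇔ printed (B) at that viscosity.**
[cite: Tao2013Localisation, footnote to (1.8)] [cite: FeffermanClay2006, (B) p. 2 and errata] -/
theorem clayPeriodicErrata_regularityAt_iff (ν : ℝ) :
    clayPeriodicErrata.RegularityAt ν ↔ clayPeriodic.RegularityAt ν :=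
  forall₄_congr fun u₀ _ _ _ => (clayPeriodic_solvable_zero_iff_errata ν u₀).symm

/-- **Errata-(B) ⇔ (B)**: Fefferman's periodic existence statement in the CMI-errata reading
(solutions with `u` AND `p` periodic) is equivalent to the printed leaf
`NavierStokesExistenceSmoothPeriodic` (only `u` periodic) — for `f ≡ 0` the pressure of a smooth
periodic-velocity solution can always be normalised. [cite: Tao2013Localisation, Lemma 4.1 (ii) and footnote to (1.8)]
[cite: FeffermanClay2006, (B) p. 2 and errata] -/
theorem clayPeriodicErrata_regularity_iff :
    clayPeriodicErrata.Regularity ↔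
      Summit.NavierStokesRegularity.NavierStokesRegularity.NavierStokesExistenceSmoothPeriodic :=
  (forall₂_congr fun ν _ => clayPeriodicErrata_regularityAt_iff ν).trans clayPeriodic_regularity_iff

/-- (B) gives errata-(B) (the direction `ClayVariants.clayPeriodicErrata_regularity_imp_printed`
lacked). [cite: Tao2013Localisation, Lemma 4.1 (ii) and footnote to (1.8)] [cite: FeffermanClay2006, (B) p. 2 and errata] -/
theorem clayPeriodicErrata_regularity_of_printed
    (h : Summit.NavierStokesRegularity.NavierStokesRegularity.NavierStokesExistenceSmoothPeriodic) :
    clayPeriodicErrata.Regularity :=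
  clayPeriodicErrata_regularity_iff.mpr h

/-- **An unforced errata-class counterexample at one viscosity is a printed-(D) witness at that
viscosity**: if some smooth divergence-free periodic datum admits, with `f ≡ 0`, NO smooth solution
with `u(·,t)` and `p(·,t)` periodic, then it admits none with `u(·,t)` periodic either, i.e.
`clayPeriodic.BreakdownAt ν`. [cite: Tao2013Localisation, Lemma 4.1 (ii), §3 eq. (galilean)]
[cite: FeffermanClay2006, (D) p. 2 and errata] -/
theorem clayPeriodic_breakdownAt_of_not_errataSolvable_zero {ν : ℝ}
    {u₀ : EuclideanSpace ℝ (Fin 3) → EuclideanSpace ℝ (Fin 3)} (hu₀ : ContDiff ℝ ∞ u₀)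
    (hdiv : NSWave0.IsDivFree u₀) (hper : IsLatticePeriodic u₀)
    (hno : ¬ clayPeriodicErrata.Solvable ν 0 u₀) : clayPeriodic.BreakdownAt ν :=
  ClaySpec.BreakdownAt.of_not_solvable (S := clayPeriodic) hu₀ hdiv hper isSmoothOnHalfSpace_zero
    clayPeriodic_force_zero fun h => hno ((clayPeriodic_solvable_zero_iff_errata ν u₀).mp h)

/-- **An UNFORCED periodic counterexample in the errata class, at ONE viscosity, proves printed (D)**
(`NavierStokesBreakdownPeriodic`, at every viscosity): combine
`clayPeriodic_breakdownAt_of_not_errataSolvable_zero` with the Δ7 scaling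
`clayPeriodic_breakdownAt_iff`. This closes the Δ5 «pressure periodic» axis for unforced periodic
breakdown claims stated with normalised (periodic) pressure. [cite: Tao2013Localisation, Lemma 4.1 (ii), §3 eq. (galilean), Rem. 1.2 footnote]
[cite: FeffermanClay2006, (D) p. 2 and errata] -/
theorem navierStokesBreakdownPeriodic_of_not_errataSolvable_zero {μ : ℝ} (hμ : 0 < μ)
    {u₀ : EuclideanSpace ℝ (Fin 3) → EuclideanSpace ℝ (Fin 3)} (hu₀ : ContDiff ℝ ∞ u₀)
    (hdiv : NSWave0.IsDivFree u₀) (hper : IsLatticePeriodic u₀)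
    (hno : ¬ clayPeriodicErrata.Solvable μ 0 u₀) :
    Summit.NavierStokesRegularity.NavierStokesRegularity.NavierStokesBreakdownPeriodic :=
  (clayPeriodic_breakdownAt_iff hμ).mp (clayPeriodic_breakdownAt_of_not_errataSolvable_zero hu₀ hdiv hper hno)

/-- The unforced one-viscosity errata witness of course also proves errata-(D)
(`NavierStokesBreakdownPeriodicPressurePeriodic`), via `clayPeriodicErrata_breakdownAt_iff`.
[cite: FeffermanClay2006, (D) p. 2 and errata] [cite: Tao2013Localisation, Rem. 1.2 footnote] -/
theorem navierStokesBreakdownPeriodicPressurePeriodic_of_not_errataSolvable_zero {μ : ℝ} (hμ : 0 < μ)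
    {u₀ : EuclideanSpace ℝ (Fin 3) → EuclideanSpace ℝ (Fin 3)} (hu₀ : ContDiff ℝ ∞ u₀)
    (hdiv : NSWave0.IsDivFree u₀) (hper : IsLatticePeriodic u₀)
    (hno : ¬ clayPeriodicErrata.Solvable μ 0 u₀) :
    Summit.NavierStokesRegularity.NavierStokesRegularity.NavierStokesBreakdownPeriodicPressurePeriodic :=
  (clayPeriodicErrata_breakdownAt_iff hμ).mp
    (ClaySpec.BreakdownAt.of_not_solvable (S := clayPeriodicErrata) hu₀ hdiv hper
      isSmoothOnHalfSpace_zero clayPeriodicErrata_force_zero hno)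

/-- **Failure of errata-(B) at one viscosity proves printed (D)** (and conversely printed (D) with an
unforced witness is failure of (B)): the unforced periodic Clay dichotomy is insensitive to the
pressure convention. [cite: Tao2013Localisation, Lemma 4.1 (ii) and footnote to (1.8)]
[cite: FeffermanClay2006, (B) (D) p. 2 and errata] -/
theorem navierStokesBreakdownPeriodic_of_not_errataRegularityAt {μ : ℝ} (hμ : 0 < μ)
    (h : ¬ clayPeriodicErrata.RegularityAt μ) :
    Summit.NavierStokesRegularity.NavierStokesRegularity.NavierStokesBreakdownPeriodic :=
  navierStokesBreakdownPeriodic_of_not_regularityAt hμ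
    fun h' => h ((clayPeriodicErrata_regularityAt_iff μ).mpr h')

end

end Literature.Claims.NS.ClayVariants

-- WHAT THIS IS NOT: not a claim about NS regularity or blow-up; not a claim about any author beyond the typed locator.
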